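import Summits.HubbardSuperconductivity.HubbardSuperconductivity.Theorems.JosephsonMirrorJmInterchangeSplit
import Summits.HubbardSuperconductivity.HubbardSuperconductivity.Theorems.JosephsonMirrorJmCuspSummitSandwich

/-!
# Crux `JmInterchange` (stmt-HubbardSuperconductivity-2227) — strategist r1: kernel companion of STRATEGY-CENSUS.md rev r1

Route `JosephsonMirror` (rev 4), crux
`Summit.HubbardSuperconductivity.HubbardSuperconductivity.Theses.JosephsonMirror.JmInterchange`
("Josephson gain of the window double at `(U, δ)` ⇒ ground-floor `d`-wave pair bridge at `(U, δ)`, for EVERY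
`U > 0`, `δ ∈ (0, 1/2)`").  This file contains NO new mathematics about the Hubbard model; it assembles, from LANDED
theorems only, the placement facts the redirect tribunal needs to close the strategist question
"is there a strategy short of the summit?" in the negative:

* `jmInterchange_iff_r1_and_r2` — the crux is EXACTLY `R1 ∧ R2` (p127245 `jmInterchange_iff_reachesFloor_and_bridges`,
  glue p155204 `jmInterchange_of_subs`): R1 = "zero-excess `d`-wave pair order reaches the ground floor" and
  R2 = "floor order bridges the adjacent charge floors", each at EVERY `(U, δ)` of the open quarter-plane.  Every line
  concluding the crux by name therefore proves R1 at every doped point — the Koma–Tasaki / Lieb–Seiringer–Yngvason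
  converse ("obscured symmetry breaking ⇒ ground-state LRO") for the `d`-wave pair field of the doped repulsive 2D
  Hubbard torus, which is open in print and FALSE in the Koma–Tasaki class (barrier
  `Literature.Barriers.HubbardSuperconductivity.SourcedOrderWithoutGroundStateLRO`, witness p149693).
* `not_jmInterchange_iff_adv` — the REFUTATION side, exactly: `¬ JmInterchange` iff at some doped point either
  `Adv₁ := ZEPO ∧ ¬FloorOrder` (an order-rich zero-excess branch over an order-poor floor) or
  `Adv₂ := FloorOrder ∧ ¬FloorBridge` (floor order not `Δ_d`-connected to the adjacent floor).  Hence
  `exists_zepo_of_not_jmInterchange` / `exists_gain_of_not_jmInterchange` / `jmInterchange_or_mirror_fires`: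
  ANY counterexample to the crux CERTIFIES zero-excess `d`-wave pair order — equivalently (p110212 `zepoGivesHyp`)
  the uniform linear Josephson gain of the window double, clause (i) of the sibling crux `JmCusp` — at an explicit
  doped point `(U, δ)` of the pure model.  By `zepo_of_hasLROAt` that is a NECESSARY condition of the summit's matrix
  `HasDWavePairFieldLROAt U δ` at that point, i.e. thermodynamic `d`-wave pairing content no controlled method reaches
  at any `U > 0`, `0 < δ < 1/2`, `T = 0` (barriers `WeakCouplingCeiling`, `StrongCouplingCeiling`,
  `PerturbativeInvisibilityOfPairing`).  And `not_hasLROAt_of_adv₁`: an `Adv₁` point is a point where the cusp fires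
  but the summit's matrix FAILS.
* `jmInterchangeAt_of_hasLROAt` / `r1At_of_hasLROAt` — at a point where the summit's matrix holds, the crux's
  R1-instance is free; the crux's content lives entirely OFF the summit's points (and on R2 at them), which is why
  neither `JmInterchange → HubbardSuperconductivity` nor `HubbardSuperconductivity → JmInterchange` is a theorem
  (probes recorded in STRATEGY-CENSUS.md rev r1, §R5).

So: PROVING the crux = R1 ∧ R2 on the whole quarter-plane (open converse + tower-collision exclusion, engine-less,
barrier-class false); REFUTING it = certifying ZEPO (the Josephson cusp) at an explicit doped point (summit-grade
input).  That is the precise sense in which the crux is summit-strength although it is neither implied by nor implies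
the summit statement.  Nothing here is a new definition of the tree: `ZEPO`, `FloorOrder`, `FloorBridge`, `GainHyp`,
`R1`, `R2`, `Adv₁`, `Adv₂` are file-local ABBREVIATIONS (plain `def`s in the crux-workfile namespace) for the
spelled-out statements of `Theorems/JosephsonMirrorJmInterchange{NormalForm,ExactResidues,Split}.lean`, and every
theorem below is a one-to-five-line composition of landed declarations (named in each docstring).

Sources: T. Koma, H. Tasaki, J. Stat. Phys. 76 (1994) 745; H. Tasaki, J. Stat. Phys. 174 (2019) 735, §5;
E. H. Lieb, R. Seiringer, J. Yngvason, Rep. Math. Phys. 59 (2007) 389, §3; D. J. Scalapino, Phys. Rep. 250 (1995)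
329, §2.  Tree: p127245, p155204, p106153, p110212, p137666, p146734, p149693 (see STRATEGY-CENSUS.md rev r1).
-/

-- the crux-workfile namespace repeats `HubbardSuperconductivity` (single-problem summit, D-0017)
set_option linter.dupNamespace false

noncomputable section

namespace Summit.HubbardSuperconductivity.HubbardSuperconductivity.Cruxes.JmInterchange.StrategyCensusR1

open Matrix Literature.MathematicalPhysics.QuantumLattice
open Literature.Barriers.HubbardSuperconductivity
open Summit.HubbardSuperconductivity.HubbardSuperconductivity.Theses.JosephsonMirror (JmInterchange)
open Summit.HubbardSuperconductivity.HubbardSuperconductivity.Theorems.JosephsonMirror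

/-! ## File-local abbreviations (spelled exactly as in the landed normal forms) -/

/-- ZERO-EXCESS `d`-WAVE PAIR ORDER at `(U, δ)` (the hypothesis of the crux in single-layer form,
`jmInterchange_iff_singleLayerForm`): some `c > 0` such that for every `ε > 0`, eventually in even `L`, a unit vector
of sector `N_L` or `N_L − 2` (`S^z = 0`) within `εL²` of its sector floor has `‖Δ_d v‖² ≥ cL⁴`.
Koma–Tasaki (1994). [folklore] -/
def ZEPO (U δ : ℝ) : Prop :=
  ∃ c : ℝ, 0 < c ∧ ∀ ε : ℝ, 0 < ε → ∃ L₀ : ℕ, ∀ (L : ℕ) [NeZero L], Even L → L₀ ≤ L →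
    ∃ n : ℕ, (n = (2 * ⌊(1 - δ) * (L : ℝ) ^ 2 / 2⌋₊) ∨ n = (2 * ⌊(1 - δ) * (L : ℝ) ^ 2 / 2⌋₊) - 2) ∧
      ∃ v : Fock (Orb (FermionTorus 2 L)), v ∈ szSector n 0 ∧ star v ⬝ᵥ v = 1 ∧
        (star v ⬝ᵥ (hubbardTorus 2 L 1 U *ᵥ v)).re ≤
            (hubbardTorus 2 L 1 U).minEnergyOn (szSector n 0) + ε * (L : ℝ) ^ 2 ∧
        c * (L : ℝ) ^ 4 ≤
          (star (pairField dWaveFormFactor L *ᵥ v) ⬝ᵥ (pairField dWaveFormFactor L *ᵥ v)).re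

/-- FLOOR ORDER at `(U, δ)`: eventually in even `L` some unit ground state `g` of `(N_L, S^z = 0)` has
`‖Δ_d g‖² ≥ cL⁴`. Scalapino (1995) §2 eq. (2.4). [folklore] -/
def FloorOrder (U δ : ℝ) : Prop :=
  ∃ c : ℝ, 0 < c ∧ ∃ L₀ : ℕ, ∀ (L : ℕ) [NeZero L], Even L → L₀ ≤ L →
    ∃ g : Fock (Orb (FermionTorus 2 L)),
      IsGroundStateInSector (hubbardTorus 2 L 1 U) (2 * ⌊(1 - δ) * (L : ℝ) ^ 2 / 2⌋₊) 0 g ∧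
      star g ⬝ᵥ g = 1 ∧
      c * (L : ℝ) ^ 4 ≤
        (star (pairField dWaveFormFactor L *ᵥ g) ⬝ᵥ (pairField dWaveFormFactor L *ᵥ g)).re

/-- GROUND-FLOOR PAIR BRIDGE at `(U, δ)` (the conclusion of the crux, verbatim): eventually some unit ground states
`φ ∈ G(N_L, 0)`, `χ ∈ G(N_L − 2, 0)` have `|⟨χ, Δ_d φ⟩|² ≥ a'L⁴`. Koma–Tasaki (1994). [folklore] -/
def FloorBridge (U δ : ℝ) : Prop :=
  ∃ a' : ℝ, 0 < a' ∧ ∃ L₀ : ℕ, ∀ (L : ℕ) [NeZero L], Even L → L₀ ≤ L → ∃ φ χ : Literature.MathematicalPhysics.QuantumLattice.Fock (Literature.MathematicalPhysics.QuantumLattice.Orb (Literature.MathematicalPhysics.QuantumLattice.FermionTorus 2 L)), Literature.MathematicalPhysics.QuantumLattice.IsGroundStateInSector (Literature.MathematicalPhysics.QuantumLattice.hubbardTorus 2 L 1 U) (2 * ⌊(1 - δ) * (L : ℝ) ^ 2 / 2⌋₊) 0 φ ∧ star φ ⬝ᵥ φ = 1 ∧ Literature.MathematicalPhysics.QuantumLattice.IsGroundStateInSector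 (Literature.MathematicalPhysics.QuantumLattice.hubbardTorus 2 L 1 U) (2 * ⌊(1 - δ) * (L : ℝ) ^ 2 / 2⌋₊ - 2) 0 χ ∧ star χ ⬝ᵥ χ = 1 ∧ a' * (L : ℝ) ^ 4 ≤ ‖star χ ⬝ᵥ Matrix.mulVec (Literature.MathematicalPhysics.QuantumLattice.pairField Literature.MathematicalPhysics.QuantumLattice.dWaveFormFactor L) φ‖ ^ 2

/-- The UNIFORM LINEAR JOSEPHSON GAIN of the window double at `(U, δ)` with rate `a` on `(0, J₀]` (the hypothesis
of the crux, verbatim: `a J L² ≤ E_L(0) − E_L(J)` for all `J ∈ (0, J₀]`, eventually in even `L`).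
Koma–Tasaki (1994). [folklore] -/
def GainHyp (U δ a J₀ : ℝ) : Prop :=
  ∀ J ∈ Set.Ioc (0:ℝ) J₀, ∃ L₀ : ℕ, ∀ (L : ℕ) [NeZero L], Even L → L₀ ≤ L → (let ι : Type := Finset (Literature.MathematicalPhysics.QuantumLattice.Orb (Literature.MathematicalPhysics.QuantumLattice.FermionTorus 2 L)); let N : ℕ := 2 * ⌊(1 - δ) * (L : ℝ) ^ 2 / 2⌋₊; let H : Matrix ι ι ℂ := Literature.MathematicalPhysics.QuantumLattice.hubbardTorus 2 L 1 U; let μ : ℝ := (H.minEnergyOn (Literature.MathematicalPhysics.QuantumLattice.szSector N 0) - H.minEnergyOn (Literature.MathematicalPhysics.QuantumLattice.szSector (N - 2) 0)) / 2; let A : Matrix ι ι ℂ := Literature.MathematicalPhysics.QuantumLattice.hubbardTorusWith 2 L 1 U μ; let D : Matrix ι ι ℂ := ((L : ℂ))⁻¹ • Literature.MathematicalPhysics.QuantumLattice.pairField Literature.MathematicalPhysics.QuantumLattice.dWaveFormFactor L; let Hd : ℝ → Matrix (ι × ι) (ι × ι) ℂ := fun J => Matrix.kroneckerMap (fun a b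 : ℂ => a * b) A 1 + Matrix.kroneckerMap (fun a b : ℂ => a * b) 1 (Matrix.transpose A) - (J : ℂ) • (Matrix.kroneckerMap (fun a b : ℂ => a * b) D (Matrix.transpose (Matrix.conjTranspose D)) + Matrix.kroneckerMap (fun a b : ℂ => a * b) (Matrix.conjTranspose D) (Matrix.transpose D)); let good : ι × ι → Prop := fun p => ((p.1.card = N ∧ p.2.card = N) ∨ (p.1.card = N - 2 ∧ p.2.card = N - 2)) ∧ (p.1.filter (fun o => (ofLex o).2 = 0)).card = (p.1.filter (fun o => (ofLex o).2 = 1)).card ∧ (p.2.filter (fun o => (ofLex o).2 = 0)).card = (p.2.filter (fun o => (ofLex o).2 = 1)).card; let S : Submodule ℂ (ι × ι → ℂ) := ⨅ (p : ι × ι) (_ : ¬ good p), LinearMap.ker (LinearMap.proj (R := ℂ) (φ := fun _ : ι × ι => ℂ) p); let E : ℝ → ℝ := fun J => (Hd J).minEnergyOn S; a * J * (L : ℝ) ^ 2 ≤ E 0 - E J)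

/-- R1 — "zero-excess pair order REACHES THE FLOOR", at every doped point (the Koma–Tasaki / LSY converse for the
`d`-wave pair field; registered stub `floorOrder_of_zeroExcessPairOrder` of line `Sketch`). [folklore] -/
def R1 : Prop := ∀ (U δ : ℝ), 0 < U → δ ∈ Set.Ioo (0:ℝ) (1 / 2) → ZEPO U δ → FloorOrder U δ

/-- R2 — "floor order BRIDGES the adjacent charge floors", at every doped point (registered stub
`floorBridge_of_floorOrder` of line `Sketch`). [folklore] -/
def R2 : Prop := ∀ (U δ : ℝ), 0 < U → δ ∈ Set.Ioo (0:ℝ) (1 / 2) → FloorOrder U δ → FloorBridge U δ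

/-- `Adv₁ (U, δ)`: an order-rich zero-excess branch over an order-poor floor (R1 fails at `(U, δ)`). [folklore] -/
def Adv₁ (U δ : ℝ) : Prop := ZEPO U δ ∧ ¬ FloorOrder U δ

/-- `Adv₂ (U, δ)`: floor order not `Δ_d`-connected to the adjacent floor (R2 fails at `(U, δ)`). [folklore] -/
def Adv₂ (U δ : ℝ) : Prop := FloorOrder U δ ∧ ¬ FloorBridge U δ

/-! ## The crux is exactly R1 ∧ R2; pointwise form -/

/-- **The crux is EXACTLY `R1 ∧ R2`** (`jmInterchange_iff_reachesFloor_and_bridges`, p127245; the curried glue is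
p155204 `jmInterchange_of_subs`). [folklore] -/
theorem jmInterchange_iff_r1_and_r2 : JmInterchange ↔ R1 ∧ R2 :=
  jmInterchange_iff_reachesFloor_and_bridges

/-- **Pointwise (mirror-free) form of the crux**: at every doped point, ZEPO ⇒ floor bridge
(`jmInterchange_iff_singleLayerForm`, p106153/p110212). [folklore] -/
theorem jmInterchange_iff_pointwise :
    JmInterchange ↔ ∀ (U δ : ℝ), 0 < U → δ ∈ Set.Ioo (0:ℝ) (1 / 2) → ZEPO U δ → FloorBridge U δ :=
  jmInterchange_iff_singleLayerForm

/-- **Pointwise form of the hypothesis**: the Josephson gain at `(U, δ)` (some `a, J₀`) iff ZEPO at `(U, δ)`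
(`josephsonGain_iff_zeroExcessPairOrder`). [folklore] -/
theorem gain_iff_zepo (U δ : ℝ) (hU : 0 < U) (hδ : δ ∈ Set.Ioo (0:ℝ) (1 / 2)) :
    (∃ a J₀ : ℝ, 0 < a ∧ 0 < J₀ ∧ GainHyp U δ a J₀) ↔ ZEPO U δ :=
  josephsonGain_iff_zeroExcessPairOrder U δ hU hδ

/-- A ground state has zero excess: floor order is zero-excess pair order (`zeroExcessPairOrder_of_floorOrder`).
[folklore] -/
theorem zepo_of_floorOrder {U δ : ℝ} (h : FloorOrder U δ) : ZEPO U δ :=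
  zeroExcessPairOrder_of_floorOrder U δ h

/-- The proof side in one line: the crux contains R1 on the whole quarter-plane. [folklore] -/
theorem r1_of_jmInterchange (h : JmInterchange) : R1 := (jmInterchange_iff_r1_and_r2.1 h).1

/-- … and R2. [folklore] -/
theorem r2_of_jmInterchange (h : JmInterchange) : R2 := (jmInterchange_iff_r1_and_r2.1 h).2

/-! ## The refutation side, exactly -/

/-- **Counterexamples to the crux are exactly the `Adv₁` / `Adv₂` points.**  `¬ JmInterchange` iff at some `U > 0`,
`δ ∈ (0, 1/2)` either ZEPO holds without floor order (`Adv₁`) or floor order holds without the floor bridge (`Adv₂`).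
Pure logic over `jmInterchange_iff_r1_and_r2`. [folklore] -/
theorem not_jmInterchange_iff_adv :
    ¬ JmInterchange ↔
      (∃ U δ : ℝ, 0 < U ∧ δ ∈ Set.Ioo (0:ℝ) (1 / 2) ∧ Adv₁ U δ) ∨
      (∃ U δ : ℝ, 0 < U ∧ δ ∈ Set.Ioo (0:ℝ) (1 / 2) ∧ Adv₂ U δ) := by
  rw [jmInterchange_iff_r1_and_r2]
  constructor
  · intro h
    by_cases h1 : R1
    · have h2 : ¬ R2 := fun h2 => h ⟨h1, h2⟩
      right
      unfold R2 at h2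
      push Not at h2
      obtain ⟨U, δ, hU, hδ, hF, hB⟩ := h2
      exact ⟨U, δ, hU, hδ, hF, hB⟩
    · left
      unfold R1 at h1
      push Not at h1
      obtain ⟨U, δ, hU, hδ, hZ, hF⟩ := h1
      exact ⟨U, δ, hU, hδ, hZ, hF⟩
  · rintro (⟨U, δ, hU, hδ, hZ, hF⟩ | ⟨U, δ, hU, hδ, hF, hB⟩) ⟨h1, h2⟩
    · exact hF (h1 U δ hU hδ hZ)
    · exact hB (h2 U δ hU hδ hF)

/-- **Any counterexample to the crux certifies zero-excess `d`-wave pair order at a doped point** (in the `Adv₂`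
branch via `zepo_of_floorOrder`). [folklore] -/
theorem exists_zepo_of_not_jmInterchange (h : ¬ JmInterchange) :
    ∃ U δ : ℝ, 0 < U ∧ δ ∈ Set.Ioo (0:ℝ) (1 / 2) ∧ ZEPO U δ := by
  rcases not_jmInterchange_iff_adv.1 h with ⟨U, δ, hU, hδ, hZ, -⟩ | ⟨U, δ, hU, hδ, hF, -⟩
  · exact ⟨U, δ, hU, hδ, hZ⟩
  · exact ⟨U, δ, hU, hδ, zepo_of_floorOrder hF⟩

/-- **Any counterexample to the crux makes the Josephson mirror FIRE somewhere**: it yields an explicit doped point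
carrying the uniform linear Josephson gain of the window double — clause (i) of the sibling crux `JmCusp` at that
point (`zepoGivesHyp`, p110212). [folklore] -/
theorem exists_gain_of_not_jmInterchange (h : ¬ JmInterchange) :
    ∃ U δ : ℝ, 0 < U ∧ δ ∈ Set.Ioo (0:ℝ) (1 / 2) ∧ ∃ a J₀ : ℝ, 0 < a ∧ 0 < J₀ ∧ GainHyp U δ a J₀ := by
  obtain ⟨U, δ, hU, hδ, hZ⟩ := exists_zepo_of_not_jmInterchange h
  exact ⟨U, δ, hU, hδ, zepoGivesHyp U δ hU hδ hZ⟩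

/-- **Dichotomy for the tribunal.**  Either the crux holds, or the uniform linear Josephson gain of the window double
is exhibited at an explicit doped point of the pure 2D repulsive Hubbard model.  (Classical.) [folklore] -/
theorem jmInterchange_or_mirror_fires :
    JmInterchange ∨
      ∃ U δ : ℝ, 0 < U ∧ δ ∈ Set.Ioo (0:ℝ) (1 / 2) ∧ ∃ a J₀ : ℝ, 0 < a ∧ 0 < J₀ ∧ GainHyp U δ a J₀ :=
  (Classical.em JmInterchange).imp_right exists_gain_of_not_jmInterchange

/-! ## Placement against the summit statement -/

/-- The summit is `∃ (U, δ), HasDWavePairFieldLROAt U δ` (by `rfl`). [folklore] -/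
theorem summit_iff_exists_hasLROAt :
    _root_.HubbardSuperconductivity ↔
      ∃ U : ℝ, 0 < U ∧ ∃ δ ∈ Set.Ioo (0:ℝ) (1 / 2), HasDWavePairFieldLROAt U δ :=
  Iff.rfl

/-- **The summit's matrix at a point gives floor order there** (uniform floor `stub_lroFloorOfHasLRO` on a chosen
unit ground state, `exists_unit_isGroundStateInSector_hubbardTorus`). [folklore] -/
theorem floorOrder_of_hasLROAt {U δ : ℝ} (hδ : δ ∈ Set.Ioo (0:ℝ) (1 / 2)) (h : HasDWavePairFieldLROAt U δ) :
    FloorOrder U δ := by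
  obtain ⟨a, ha, L₀, hfloor⟩ := stub_lroFloorOfHasLRO U δ hδ.1.le h
  refine ⟨a, ha, L₀, fun L _ hE hL => ?_⟩
  obtain ⟨g, hg1, hgs⟩ := exists_unit_isGroundStateInSector_hubbardTorus U L ⌊(1 - δ) * (L : ℝ) ^ 2 / 2⌋₊
    (natFloor_filling_le_sq (δ := δ) (by linarith [hδ.1]) L)
  exact ⟨g, hgs, hg1, hfloor L hE hL g hgs hg1⟩

/-- **ZEPO is a necessary condition of the summit's matrix at a point.** [folklore] -/
theorem zepo_of_hasLROAt {U δ : ℝ} (hδ : δ ∈ Set.Ioo (0:ℝ) (1 / 2)) (h : HasDWavePairFieldLROAt U δ) :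
    ZEPO U δ :=
  zepo_of_floorOrder (floorOrder_of_hasLROAt hδ h)

/-- **An `Adv₁` counterexample to the crux at `(U, δ)` refutes the summit's matrix AT THAT POINT** (while certifying
its necessary condition ZEPO there): the cusp fires, the floor is order-poor. [folklore] -/
theorem not_hasLROAt_of_adv₁ {U δ : ℝ} (hδ : δ ∈ Set.Ioo (0:ℝ) (1 / 2)) (h : Adv₁ U δ) :
    ¬ HasDWavePairFieldLROAt U δ :=
  fun hS => h.2 (floorOrder_of_hasLROAt hδ hS)

/-- **At a point where the summit's matrix holds, the crux's R1-instance is free** (its conclusion holds outright).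
The crux's R1-content lives OFF the summit's points. [folklore] -/
theorem r1At_of_hasLROAt {U δ : ℝ} (hδ : δ ∈ Set.Ioo (0:ℝ) (1 / 2)) (h : HasDWavePairFieldLROAt U δ) :
    ZEPO U δ → FloorOrder U δ :=
  fun _ => floorOrder_of_hasLROAt hδ h

/-- **What the crux does at a summit point**: with the crux, the summit's matrix at `(U, δ)` yields the ground-floor
pair bridge there (the route's use of the crux, pointwise). [folklore] -/
theorem floorBridge_of_jmInterchange_of_hasLROAt (hJ : JmInterchange) {U δ : ℝ} (hU : 0 < U)
    (hδ : δ ∈ Set.Ioo (0:ℝ) (1 / 2)) (h : HasDWavePairFieldLROAt U δ) : FloorBridge U δ :=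
  (jmInterchange_iff_pointwise.1 hJ) U δ hU hδ (zepo_of_hasLROAt hδ h)

/-- **The summit alone settles no instance of R2 and no off-point instance of R1**: formally, all the summit gives
toward the crux is, at its own point, ZEPO (the crux's HYPOTHESIS) — recorded as the implication actually available.
[folklore] -/
theorem exists_zepo_of_summit (hS : _root_.HubbardSuperconductivity) :
    ∃ U δ : ℝ, 0 < U ∧ δ ∈ Set.Ioo (0:ℝ) (1 / 2) ∧ ZEPO U δ := by
  obtain ⟨U, hU, δ, hδ, h⟩ := hS
  exact ⟨U, δ, hU, hδ, zepo_of_hasLROAt hδ h⟩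

end Summit.HubbardSuperconductivity.HubbardSuperconductivity.Cruxes.JmInterchange.StrategyCensusR1

end
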